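import Literature.Analysis.Calculus.SmoothCutoff
import Literature.Analysis.FluidPDE.AxisymmetricVorticityTransport
import Literature.Analysis.FluidPDE.MeridianReduction
import Literature.Analysis.FluidPDE.WholeSpaceIBP
import HarnessLib

/-!
# The axisymmetric space–time cut-off of KNSS 2009, proof of Theorem 5.3

Analysis/FluidPDE support file for the decomposition of KNSS 2009, Theorem 5.3
(`KNSSSwirlLiouville`, named fact `KNSS2009_swirl_sup_nonpos`). Koch–Nadirashvili–Seregin–Šverák,
Acta Math. 203 (2009) = arXiv:0709.3599, p. 10, test the swirl equation (5.10) against "a smooth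
axi-symmetric cut-off function `φ(x,t)` supported in `{r ≤ δ+R, −L+z̄ ≤ x₃ ≤ L+z̄} × (t̄ − T₁, t̄)`
such that `φ = 1` in `{r ≤ δ+R−1, −L+1+z̄ ≤ x₃ ≤ L−1+z̄} × (t̄−T₁+1, t̄−1)` and, moreover,
`|φₜ| ≤ 1`, `|φ_{,r}| ≤ 1`, `|φ_{,z}| ≤ 1` everywhere. (A natural choice is, for example,
`φ(r,z,t) = ξ(r)η(z)ζ(t)` for suitable functions `ξ, η, ζ` of one variable.)" This file builds
that choice with `δ = R = 1`, `z̄ = 0` and the time window `(1, T)`, from Mathlib's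
`Real.smoothTransition` `S` (`S = 0` on `(−∞, 0]`, `S = 1` on `[1, ∞)`, smooth, monotone):

* `xiCut ρ = S(2 − ρ)` (radial profile: `1` for `ρ ≤ 1`, `0` for `ρ ≥ 2`, nonincreasing); the
  axial profile is the tree's plateau cut-off `η_L = Calculus.cutoff L`
  (`Literature.Analysis.Calculus.cutoff L z = S(z + L) S(L − z)`: `1` on `[−(L−1), L−1]`, `0` off
  `(−L, L)`), for which this file adds the second derivative and its uniform bound;
  `zetaCut T s = Calculus.cutoff ((T−1)/2) (s − (T+1)/2)` (time: `1` on `[2, T−1]`, `0` off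
  `(1, T)`);
* `phiCut L T s y = xiCut (r y) · Calculus.cutoff L (y₂) · zetaCut T s` on `ℝ × ℝ³`: smooth and
  compactly supported in `y`, axisymmetric, `0 ≤ φ ≤ 1`; its time derivative; its radial derivative
  `Dφ[e_r] = ξ'(r) η ζ` ((5.19)–(5.20)); and on the unit cylinder `{r < 1}` (where `ξ(r) = 1`)
  the explicit gradient `ζ η'(y₂) dy₂` and Laplacian `ζ η''(y₂)` ((5.18): the bounds
  `|I| ≤ C L δ²`, `|II| ≤ C δ T₁` only integrate over `{r ≤ δ}`);
* uniform bounds: `|S'|, |S''| ≤ C_S` (first derivative: the tree's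
  `exists_bound_deriv_smoothTransition`; second derivative here), hence `|∂ₛφ|, |η'|, |η''|`
  bounded independently of `L, T`, with `η', η''` supported in the two unit slabs
  `L − 1 ≤ |z| ≤ L` and `∂ₛφ` in the two unit time intervals; global (non-uniform) bounds for
  `Dφ`, `Δφ` by compactness.

All statements are folklore calculus. [cite: KochNadirashviliSereginSverak2009, proof of Thm 5.3, (5.15)–(5.16) (arXiv p. 10)]

## References

* G. Koch, N. Nadirashvili, G. Seregin, V. Šverák, *Liouville theorems for the Navier–Stokes
  equations and applications*, Acta Math. 203 (2009) = arXiv:0709.3599, proof of Theorem 5.3,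
  (5.15)–(5.20), p. 10. [KochNadirashviliSereginSverak2009]
-/

noncomputable section

open MeasureTheory Set Function Filter Topology TopologicalSpace WithLp Metric Real InnerProductSpace
open scoped Laplacian RealInnerProductSpace ContDiff

namespace Literature.Analysis.FluidPDE

/-- Local notation for physical space `ℝ³ = EuclideanSpace ℝ (Fin 3)`. -/
local notation "ℝ³" => EuclideanSpace ℝ (Fin 3)

-- the plateau cut-off `cutoff R s = S(s + R) S(R − s)` and the calculus of `Real.smoothTransition`
-- are the tree's (`Literature/Analysis/Calculus/SmoothCutoff`)
-- (the plateau cut-off is referred to as `Calculus.cutoff`, since `FluidPDE.cutoff` of `WholeSpaceIBP`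
-- is the radial cut-off on a normed space)
open Literature.Analysis.Calculus (differentiable_smoothTransition deriv_smoothTransition_of_nonpos
  deriv_smoothTransition_of_one_le exists_bound_deriv_smoothTransition)

/-! ### Bounds on the derivatives of `Real.smoothTransition` -/

section OneD

/-- The derivative of `smoothTransition` vanishes near every point of `(−∞, 0)`. [folklore] -/
theorem deriv_smoothTransition_eventuallyEq_zero_of_neg {x : ℝ} (hx : x < 0) :
    deriv smoothTransition =ᶠ[𝓝 x] fun _ => (0 : ℝ) := by
  filter_upwards [Iio_mem_nhds hx] with y hy
  exact deriv_smoothTransition_of_nonpos hy.le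

/-- The derivative of `smoothTransition` vanishes near every point of `(1, ∞)`. [folklore] -/
theorem deriv_smoothTransition_eventuallyEq_zero_of_one_lt {x : ℝ} (hx : 1 < x) :
    deriv smoothTransition =ᶠ[𝓝 x] fun _ => (0 : ℝ) := by
  filter_upwards [Ioi_mem_nhds hx] with y hy
  exact deriv_smoothTransition_of_one_le hy.le

/-- The derivative of `smoothTransition` is differentiable. [folklore] -/
theorem differentiable_deriv_smoothTransition : Differentiable ℝ (deriv smoothTransition) := by
  have h : ContDiff ℝ ∞ (deriv smoothTransition) := by
    simpa using smoothTransition.contDiff.iterate_deriv 1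
  exact h.differentiable (by simp)

/-- **Uniform bound on the second derivative of `smoothTransition`**: `|S''| ≤ C` on `ℝ`
(continuous and zero off `[0, 1]`). [folklore] -/
theorem exists_bound_deriv_deriv_smoothTransition :
    ∃ C : ℝ, 0 ≤ C ∧ ∀ x, |deriv (deriv smoothTransition) x| ≤ C := by
  have hc2 : Continuous (deriv (deriv smoothTransition)) := by
    simpa [Function.iterate_succ_apply'] using (smoothTransition.contDiff.iterate_deriv 2).continuous
  obtain ⟨C₂, hC₂⟩ := (isCompact_Icc (a := (0 : ℝ)) (b := 1)).exists_bound_of_continuousOn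
    hc2.continuousOn
  refine ⟨|C₂|, abs_nonneg _, fun x => ?_⟩
  by_cases hx : x ∈ Icc (0 : ℝ) 1
  · exact (Real.norm_eq_abs _ ▸ hC₂ x hx).trans (le_abs_self _)
  · rw [mem_Icc, not_and_or, not_le, not_le] at hx
    rcases hx with hx | hx
    · rw [(deriv_smoothTransition_eventuallyEq_zero_of_neg hx).deriv_eq, deriv_const, abs_zero]
      exact abs_nonneg _
    · rw [(deriv_smoothTransition_eventuallyEq_zero_of_one_lt hx).deriv_eq, deriv_const, abs_zero]
      exact abs_nonneg _

/-- A common uniform bound `C_S ≥ 0` for `|S'|` (the tree's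
`Literature.Analysis.Calculus.exists_bound_deriv_smoothTransition`) and `|S''|` (a `C²` bound; the
`S'`-only constants `Literature.Topology.FourManifolds.smoothTransitionDerivBound` and
`Literature.Analysis.Calculus.exists_bound_deriv_cutoff` are different objects). [folklore] -/
def smoothTransitionC2Bound : ℝ :=
  max exists_bound_deriv_smoothTransition.choose exists_bound_deriv_deriv_smoothTransition.choose

/-- `C_S ≥ 0`. [folklore] -/
theorem smoothTransitionC2Bound_nonneg : 0 ≤ smoothTransitionC2Bound :=
  le_max_of_le_left exists_bound_deriv_smoothTransition.choose_spec.1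

/-- `|S'| ≤ C_S`. [folklore] -/
theorem abs_deriv_smoothTransition_le (x : ℝ) :
    |deriv smoothTransition x| ≤ smoothTransitionC2Bound :=
  (exists_bound_deriv_smoothTransition.choose_spec.2 x).trans (le_max_left _ _)

/-- `|S''| ≤ C_S`. [folklore] -/
theorem abs_deriv_deriv_smoothTransition_le (x : ℝ) :
    |deriv (deriv smoothTransition) x| ≤ smoothTransitionC2Bound :=
  (exists_bound_deriv_deriv_smoothTransition.choose_spec.2 x).trans (le_max_right _ _)

/-! ### The radial profile `ξ` -/

/-- The radial profile `ξ(ρ) = S(2 − ρ)`: `1` for `ρ ≤ 1`, `0` for `ρ ≥ 2`, smooth and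
nonincreasing (KNSS 2009, (5.15)–(5.16) with `δ = R = 1`). [cite: KochNadirashviliSereginSverak2009, proof of Thm 5.3, (5.15)–(5.16) (arXiv p. 10)] -/
def xiCut (ρ : ℝ) : ℝ := smoothTransition (2 - ρ)

/-- `ξ = 1` on `(−∞, 1]`. [folklore] -/
theorem xiCut_of_le_one {ρ : ℝ} (h : ρ ≤ 1) : xiCut ρ = 1 :=
  smoothTransition.one_of_one_le (by linarith)

/-- `ξ = 0` on `[2, ∞)`. [folklore] -/
theorem xiCut_of_two_le {ρ : ℝ} (h : 2 ≤ ρ) : xiCut ρ = 0 :=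
  smoothTransition.zero_of_nonpos (by linarith)

/-- `0 ≤ ξ ≤ 1`. [folklore] -/
theorem xiCut_mem_Icc (ρ : ℝ) : xiCut ρ ∈ Icc (0 : ℝ) 1 :=
  ⟨smoothTransition.nonneg _, smoothTransition.le_one _⟩

/-- `ξ` is smooth. [folklore] -/
theorem contDiff_xiCut {n : ℕ∞} : ContDiff ℝ n xiCut :=
  smoothTransition.contDiff.comp (contDiff_const.sub contDiff_id)

/-- The derivative of `ξ`: `ξ'(ρ) = −S'(2 − ρ)`. [folklore] -/
theorem hasDerivAt_xiCut (ρ : ℝ) : HasDerivAt xiCut (-deriv smoothTransition (2 - ρ)) ρ :=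
  (differentiable_smoothTransition (2 - ρ)).hasDerivAt.comp_const_sub 2 ρ

/-- `ξ' = −S'(2 − ·)`. [folklore] -/
theorem deriv_xiCut (ρ : ℝ) : deriv xiCut ρ = -deriv smoothTransition (2 - ρ) :=
  (hasDerivAt_xiCut ρ).deriv

/-- `ξ' ≤ 0`. [folklore] -/
theorem deriv_xiCut_nonpos (ρ : ℝ) : deriv xiCut ρ ≤ 0 := by
  rw [deriv_xiCut]
  linarith [smoothTransition.monotone.deriv_nonneg (x := 2 - ρ)]

/-- `|ξ'| ≤ C_S`. [folklore] -/
theorem abs_deriv_xiCut_le (ρ : ℝ) : |deriv xiCut ρ| ≤ smoothTransitionC2Bound := by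
  rw [deriv_xiCut, abs_neg]; exact abs_deriv_smoothTransition_le _

/-- `ξ' = 0` on `(−∞, 1)`. [folklore] -/
theorem deriv_xiCut_of_lt_one {ρ : ℝ} (h : ρ < 1) : deriv xiCut ρ = 0 := by
  rw [deriv_xiCut, deriv_smoothTransition_of_one_le (by linarith), neg_zero]

/-- `ξ' = 0` on `(2, ∞)`. [folklore] -/
theorem deriv_xiCut_of_two_lt {ρ : ℝ} (h : 2 < ρ) : deriv xiCut ρ = 0 := by
  rw [deriv_xiCut, deriv_smoothTransition_of_nonpos (by linarith), neg_zero]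

/-- **The radial integral of `ξ'`**: `∫₀^∞ ξ'(ρ) dρ = −1` (`ξ(∞) − ξ(0) = 0 − 1`). [folklore] -/
theorem integral_deriv_xiCut_Ioi : ∫ ρ in Ioi (0 : ℝ), deriv xiCut ρ = -1 := by
  have hint : IntegrableOn (deriv xiCut) (Ioi 0) := by
    have hc : Continuous (deriv xiCut) := by
      rw [show deriv xiCut = fun ρ => -deriv smoothTransition (2 - ρ) from funext deriv_xiCut]
      have : Continuous (deriv smoothTransition) :=
        differentiable_deriv_smoothTransition.continuous
      fun_prop
    refine (hc.integrable_of_hasCompactSupport ?_).integrableOn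
    refine HasCompactSupport.intro (isCompact_Icc (a := (1 : ℝ)) (b := 2)) fun ρ hρ => ?_
    rw [mem_Icc, not_and_or, not_le, not_le] at hρ
    rcases hρ with hρ | hρ
    · exact deriv_xiCut_of_lt_one hρ
    · exact deriv_xiCut_of_two_lt hρ
  have hlim : Tendsto xiCut atTop (𝓝 0) := by
    apply tendsto_const_nhds.congr'
    filter_upwards [eventually_ge_atTop (2 : ℝ)] with ρ hρ
    exact (xiCut_of_two_le hρ).symm
  rw [integral_Ioi_of_hasDerivAt_of_tendsto' (fun ρ _ => (contDiff_xiCut (n := 1)).differentiable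
    one_ne_zero ρ |>.hasDerivAt) hint hlim, xiCut_of_le_one zero_le_one]
  norm_num

/-! ### The axial profile `η_L = Calculus.cutoff L`: second derivative -/

/-- `|η'| ≤ 2 C_S` for the plateau cut-off `η_L = Calculus.cutoff L` (the tree's
`exists_bound_deriv_cutoff`, with the named constant). [folklore] -/
theorem abs_deriv_etaCut_le (L z : ℝ) :
    |deriv (Calculus.cutoff L) z| ≤ 2 * smoothTransitionC2Bound := by
  rw [Calculus.deriv_cutoff]
  have h1 := abs_deriv_smoothTransition_le (z + L)
  have h2 := abs_deriv_smoothTransition_le (L - z)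
  have h3 : |smoothTransition (L - z)| ≤ 1 := by
    rw [abs_of_nonneg (smoothTransition.nonneg _)]; exact smoothTransition.le_one _
  have h4 : |smoothTransition (z + L)| ≤ 1 := by
    rw [abs_of_nonneg (smoothTransition.nonneg _)]; exact smoothTransition.le_one _
  have h0 := smoothTransitionC2Bound_nonneg
  calc |deriv smoothTransition (z + L) * smoothTransition (L - z) -
        smoothTransition (z + L) * deriv smoothTransition (L - z)|
      ≤ |deriv smoothTransition (z + L) * smoothTransition (L - z)| +
        |smoothTransition (z + L) * deriv smoothTransition (L - z)| := abs_sub _ _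
    _ ≤ smoothTransitionC2Bound * 1 + 1 * smoothTransitionC2Bound := by
        rw [abs_mul, abs_mul]
        gcongr
    _ = 2 * smoothTransitionC2Bound := by ring

/-- **The second derivative of the plateau cut-off**: `η'` is differentiable with
`η'' = S''(z+L) S(L−z) − 2 S'(z+L) S'(L−z) + S(z+L) S''(L−z)`. [folklore] -/
theorem hasDerivAt_deriv_etaCut (L z : ℝ) : HasDerivAt (deriv (Calculus.cutoff L))
    (deriv (deriv smoothTransition) (z + L) * smoothTransition (L - z) -
      2 * (deriv smoothTransition (z + L) * deriv smoothTransition (L - z)) +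
      smoothTransition (z + L) * deriv (deriv smoothTransition) (L - z)) z := by
  have hS := differentiable_smoothTransition
  have hS' := differentiable_deriv_smoothTransition
  have hA : HasDerivAt (fun z => deriv smoothTransition (z + L))
      (deriv (deriv smoothTransition) (z + L)) z := (hS' (z + L)).hasDerivAt.comp_add_const z L
  have hB : HasDerivAt (fun z => smoothTransition (L - z)) (-deriv smoothTransition (L - z)) z :=
    (hS (L - z)).hasDerivAt.comp_const_sub L z
  have hC : HasDerivAt (fun z => smoothTransition (z + L)) (deriv smoothTransition (z + L)) z :=
    (hS (z + L)).hasDerivAt.comp_add_const z L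
  have hD : HasDerivAt (fun z => deriv smoothTransition (L - z))
      (-deriv (deriv smoothTransition) (L - z)) z := (hS' (L - z)).hasDerivAt.comp_const_sub L z
  have hfun : deriv (Calculus.cutoff L) = fun z => deriv smoothTransition (z + L) * smoothTransition (L - z) -
      smoothTransition (z + L) * deriv smoothTransition (L - z) := funext (Calculus.deriv_cutoff L)
  rw [hfun]
  exact ((hA.mul hB).sub (hC.mul hD)).congr_deriv (by ring)

/-- `|η''| ≤ 4 C_S (C_S + 1)`, a bound independent of `L`. [folklore] -/
theorem abs_deriv_deriv_etaCut_le (L z : ℝ) : |deriv (deriv (Calculus.cutoff L)) z| ≤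
    4 * smoothTransitionC2Bound * (smoothTransitionC2Bound + 1) := by
  rw [(hasDerivAt_deriv_etaCut L z).deriv]
  set C := smoothTransitionC2Bound with hC
  have hC0 : 0 ≤ C := smoothTransitionC2Bound_nonneg
  have h1 := abs_deriv_deriv_smoothTransition_le (z + L)
  have h2 := abs_deriv_deriv_smoothTransition_le (L - z)
  have h3 := abs_deriv_smoothTransition_le (z + L)
  have h4 := abs_deriv_smoothTransition_le (L - z)
  have h5 : |smoothTransition (L - z)| ≤ 1 := by
    rw [abs_of_nonneg (smoothTransition.nonneg _)]; exact smoothTransition.le_one _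
  have h6 : |smoothTransition (z + L)| ≤ 1 := by
    rw [abs_of_nonneg (smoothTransition.nonneg _)]; exact smoothTransition.le_one _
  rw [← hC] at h1 h2 h3 h4
  set X := deriv (deriv smoothTransition) (z + L) * smoothTransition (L - z) with hX
  set Y := 2 * (deriv smoothTransition (z + L) * deriv smoothTransition (L - z)) with hY
  set Z := smoothTransition (z + L) * deriv (deriv smoothTransition) (L - z) with hZ
  have hX' : |X| ≤ C * 1 := by rw [hX, abs_mul]; gcongr
  have hY' : |Y| ≤ 2 * (C * C) := by
    rw [hY, abs_mul, abs_mul, abs_two]; gcongr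
  have hZ' : |Z| ≤ 1 * C := by rw [hZ, abs_mul]; gcongr
  calc |X - Y + Z| ≤ |X - Y| + |Z| := abs_add_le _ _
    _ ≤ |X| + |Y| + |Z| := by linarith [abs_sub X Y]
    _ ≤ C * 1 + 2 * (C * C) + 1 * C := by linarith
    _ ≤ 4 * C * (C + 1) := by nlinarith

/-- `η''` vanishes on the open plateau `|z| < L − 1`. [folklore] -/
theorem deriv_deriv_etaCut_of_abs_lt {L z : ℝ} (h : |z| < L - 1) :
    deriv (deriv (Calculus.cutoff L)) z = 0 := by
  have hopen : IsOpen {w : ℝ | |w| < L - 1} := isOpen_lt continuous_abs continuous_const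
  have hev : deriv (Calculus.cutoff L) =ᶠ[𝓝 z] fun _ => (0 : ℝ) := by
    filter_upwards [hopen.mem_nhds h] with w hw
    exact Calculus.deriv_cutoff_eq_zero_of_lt hw
  rw [hev.deriv_eq, deriv_const]

/-- `η''` vanishes outside `[−L, L]`. [folklore] -/
theorem deriv_deriv_etaCut_of_lt_abs {L z : ℝ} (h : L < |z|) :
    deriv (deriv (Calculus.cutoff L)) z = 0 := by
  have hopen : IsOpen {w : ℝ | L < |w|} := isOpen_lt continuous_const continuous_abs
  have hev : deriv (Calculus.cutoff L) =ᶠ[𝓝 z] fun _ => (0 : ℝ) := by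
    filter_upwards [hopen.mem_nhds h] with w hw
    exact Calculus.deriv_cutoff_eq_zero_of_le hw.le
  rw [hev.deriv_eq, deriv_const]

/-- `0 ≤ η ≤ 1` for the plateau cut-off. [folklore] -/
theorem etaCut_mem_Icc (L z : ℝ) : Calculus.cutoff L z ∈ Icc (0 : ℝ) 1 :=
  ⟨Calculus.cutoff_nonneg L z, Calculus.cutoff_le_one L z⟩

/-! ### The time profile `ζ_T` -/

/-- The time profile `ζ_T(s) = η_{(T−1)/2}(s − (T+1)/2) = S(s − 1) S(T − s)`: `1` on `[2, T−1]`,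
`0` off `(1, T)` (KNSS 2009, (5.15)–(5.16) with `t̄ = T`, `T₁ = T − 1`). [cite: KochNadirashviliSereginSverak2009, proof of Thm 5.3, (5.15)–(5.16) (arXiv p. 10)] -/
def zetaCut (T s : ℝ) : ℝ := Calculus.cutoff ((T - 1) / 2) (s - (T + 1) / 2)

/-- `ζ_T(s) = S(s − 1) S(T − s)`. [folklore] -/
theorem zetaCut_eq (T s : ℝ) : zetaCut T s = smoothTransition (s - 1) * smoothTransition (T - s) := by
  rw [zetaCut, Calculus.cutoff]
  congr 2 <;> ring

/-- `0 ≤ ζ ≤ 1`. [folklore] -/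
theorem zetaCut_mem_Icc (T s : ℝ) : zetaCut T s ∈ Icc (0 : ℝ) 1 := etaCut_mem_Icc _ _

/-- `ζ_T = 1` on `[2, T − 1]`. [folklore] -/
theorem zetaCut_of_mem_Icc {T s : ℝ} (h : s ∈ Icc 2 (T - 1)) : zetaCut T s = 1 := by
  rw [zetaCut_eq, smoothTransition.one_of_one_le (by linarith [h.1]),
    smoothTransition.one_of_one_le (by linarith [h.2]), mul_one]

/-- `ζ_T = 0` off `(1, T)`. [folklore] -/
theorem zetaCut_of_not_mem_Ioo {T s : ℝ} (h : s ∉ Ioo 1 T) : zetaCut T s = 0 := by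
  rw [mem_Ioo, not_and_or, not_lt, not_lt] at h
  rcases h with h | h
  · rw [zetaCut_eq, smoothTransition.zero_of_nonpos (x := s - 1) (by linarith), zero_mul]
  · rw [zetaCut_eq, smoothTransition.zero_of_nonpos (x := T - s) (by linarith), mul_zero]

/-- `ζ_T` is smooth. [folklore] -/
theorem contDiff_zetaCut (T : ℝ) {n : ℕ∞} : ContDiff ℝ n (zetaCut T) :=
  (Calculus.contDiff_cutoff _).comp (contDiff_id.sub contDiff_const)

/-- The derivative of `ζ_T` in terms of `η'`. [folklore] -/
theorem deriv_zetaCut (T s : ℝ) :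
    deriv (zetaCut T) s = deriv (Calculus.cutoff ((T - 1) / 2)) (s - (T + 1) / 2) := by
  rw [show zetaCut T = fun s => Calculus.cutoff ((T - 1) / 2) (s - (T + 1) / 2) from rfl,
    deriv_comp_sub_const]

/-- `|ζ'| ≤ 2 C_S`. [folklore] -/
theorem abs_deriv_zetaCut_le (T s : ℝ) : |deriv (zetaCut T) s| ≤ 2 * smoothTransitionC2Bound := by
  rw [deriv_zetaCut]; exact abs_deriv_etaCut_le _ _

/-- `ζ'` vanishes on the plateau `(2, T − 1)` and off `[1, T]`: it is supported in the two unit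
intervals `[1, 2] ∪ [T − 1, T]`. [folklore] -/
theorem deriv_zetaCut_eq_zero {T s : ℝ} (h : s ∉ Icc 1 2 ∪ Icc (T - 1) T) :
    deriv (zetaCut T) s = 0 := by
  rw [deriv_zetaCut]
  simp only [mem_union, mem_Icc, not_or, not_and_or, not_le] at h
  obtain ⟨h1, h2⟩ := h
  by_cases hs : s < 1
  · exact Calculus.deriv_cutoff_eq_zero_of_le (by rw [le_abs]; right; linarith)
  · by_cases hs' : T < s
    · exact Calculus.deriv_cutoff_eq_zero_of_le (by rw [le_abs]; left; linarith)
    · simp only [not_lt] at hs hs'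
      have h2s : 2 < s := by rcases h1 with h1 | h1 <;> [linarith; linarith]
      have hsT : s < T - 1 := by rcases h2 with h2 | h2 <;> [linarith; linarith]
      exact Calculus.deriv_cutoff_eq_zero_of_lt (by rw [abs_lt]; constructor <;> linarith)

/-- `ζ_T` is differentiable with the derivative `deriv (zetaCut T)`. [folklore] -/
theorem hasDerivAt_zetaCut (T s : ℝ) : HasDerivAt (zetaCut T) (deriv (zetaCut T) s) s :=
  ((contDiff_zetaCut T (n := 1)).differentiable one_ne_zero s).hasDerivAt

end OneD

/-! ### Calculus of the cylindrical radius off the axis -/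

section Radius

/-- Off the axis the argument of the square root in `r = √(y₀² + y₁²)` is nonzero. [folklore] -/
theorem sq_add_sq_ne_zero_of_cylRadius_ne_zero {y : ℝ³} (hy : cylRadius y ≠ 0) :
    y 0 ^ 2 + y 1 ^ 2 ≠ 0 := fun h => hy (by rw [cylRadius, h, Real.sqrt_zero])

/-- The horizontal square `y ↦ y₀² + y₁²` is smooth. [folklore] -/
theorem contDiff_sq_add_sq {n : WithTop ℕ∞} : ContDiff ℝ n fun y : ℝ³ => y 0 ^ 2 + y 1 ^ 2 := by
  have h0 : ContDiff ℝ n (fun y : ℝ³ => y 0) := (EuclideanSpace.proj (0 : Fin 3) : ℝ³ →L[ℝ] ℝ).contDiff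
  have h1 : ContDiff ℝ n (fun y : ℝ³ => y 1) := (EuclideanSpace.proj (1 : Fin 3) : ℝ³ →L[ℝ] ℝ).contDiff
  exact (h0.pow 2).add (h1.pow 2)

/-- **The cylindrical radius is smooth off the axis.** [folklore] -/
theorem contDiffAt_cylRadius {y : ℝ³} (hy : cylRadius y ≠ 0) {n : WithTop ℕ∞} :
    ContDiffAt ℝ n cylRadius y :=
  contDiff_sq_add_sq.contDiffAt.sqrt (sq_add_sq_ne_zero_of_cylRadius_ne_zero hy)

/-- **The radial derivative of the radius is `1`**: `Dr(y)[e_r(y)] = 1` off the axis (the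
gradient of `r` is `e_r`, `hasFDerivAt_cylRadius` of `MeridianReduction`). [folklore] -/
theorem fderiv_cylRadius_apply_eR {y : ℝ³} (hy : cylRadius y ≠ 0) :
    fderiv ℝ cylRadius y (eR y) = 1 := by
  rw [(hasFDerivAt_cylRadius hy).fderiv, innerSL_apply_apply, inner_eR_self hy]

end Radius

/-! ### The spatial cut-off `ψ_L = ξ(r) η_L(x₂)`, `η_L = Calculus.cutoff L` and the space–time cut-off `φ = ψ_L ζ_T` -/

section ThreeD

/-- The spatial cut-off `ψ_L(y) = ξ(r(y)) η_L(y₂)` (KNSS 2009, (5.15)–(5.16): supported in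
`{r ≤ 2, |y₂| ≤ L}`, equal to `1` on `{r ≤ 1, |y₂| ≤ L − 1}`). [cite: KochNadirashviliSereginSverak2009, proof of Thm 5.3, (5.15)–(5.16) (arXiv p. 10)] -/
def psiCut (L : ℝ) (y : ℝ³) : ℝ := xiCut (cylRadius y) * Calculus.cutoff L (y 2)

/-- **The cut-off** `φ(s, y) = ψ_L(y) ζ_T(s) = ξ(r(y)) η_L(y₂) ζ_T(s)` of KNSS 2009, (5.15)–(5.16)
(with `δ = R = 1`, `z̄ = 0`, time window `(1, T)`). [cite: KochNadirashviliSereginSverak2009, proof of Thm 5.3, (5.15)–(5.16) (arXiv p. 10)] -/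
def phiCut (L T : ℝ) (s : ℝ) (y : ℝ³) : ℝ := psiCut L y * zetaCut T s

/-- Unfolding `φ = ξ η ζ`. [folklore] -/
theorem phiCut_apply (L T s : ℝ) (y : ℝ³) :
    phiCut L T s y = xiCut (cylRadius y) * Calculus.cutoff L (y 2) * zetaCut T s := rfl

/-- **`y ↦ ξ(r(y))` is smooth on `ℝ³`**: it is constant `1` on the open unit cylinder (which
contains the axis, where `r` is not differentiable) and a composition of smooth maps off the
axis. [folklore] -/
theorem contDiff_xiCut_comp_cylRadius {n : ℕ∞} : ContDiff ℝ n fun y : ℝ³ => xiCut (cylRadius y) := by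
  rw [contDiff_iff_contDiffAt]
  intro y
  by_cases hy : cylRadius y < 1
  · have hev : (fun y : ℝ³ => xiCut (cylRadius y)) =ᶠ[𝓝 y] fun _ => (1 : ℝ) := by
      filter_upwards [(isOpen_lt continuous_cylRadius continuous_const).mem_nhds hy] with w hw
      exact xiCut_of_le_one (le_of_lt hw)
    exact contDiffAt_const.congr_of_eventuallyEq hev
  · have hne : cylRadius y ≠ 0 := by intro h; rw [h] at hy; exact hy one_pos
    exact (contDiff_xiCut (n := n)).contDiffAt.comp y (contDiffAt_cylRadius hne)

/-- `y ↦ η_L(y₂)` is smooth. [folklore] -/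
theorem contDiff_etaCut_comp_apply_two (L : ℝ) {n : ℕ∞} :
    ContDiff ℝ n fun y : ℝ³ => Calculus.cutoff L (y 2) :=
  (Calculus.contDiff_cutoff L).comp (EuclideanSpace.proj (2 : Fin 3) : ℝ³ →L[ℝ] ℝ).contDiff

/-- The derivative of `y ↦ η_L(y₂)`: `D[η(y₂)] = η'(y₂) dy₂`. [folklore] -/
theorem hasFDerivAt_etaCut_comp_apply_two (L : ℝ) (y : ℝ³) :
    HasFDerivAt (fun w : ℝ³ => Calculus.cutoff L (w 2))
      (deriv (Calculus.cutoff L) (y 2) • (EuclideanSpace.proj (2 : Fin 3) : ℝ³ →L[ℝ] ℝ)) y := by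
  have hd := (Calculus.contDiff_cutoff L (n := 1)).differentiable one_ne_zero (y 2)
  exact hd.hasDerivAt.comp_hasFDerivAt y (EuclideanSpace.proj (2 : Fin 3) : ℝ³ →L[ℝ] ℝ).hasFDerivAt

/-- **`ψ_L` is smooth.** [folklore] -/
theorem contDiff_psiCut (L : ℝ) {n : ℕ∞} : ContDiff ℝ n (psiCut L) :=
  contDiff_xiCut_comp_cylRadius.mul (contDiff_etaCut_comp_apply_two L)

/-- **`φ(s, ·)` is smooth.** [folklore] -/
theorem contDiff_phiCut (L T s : ℝ) {n : ℕ∞} : ContDiff ℝ n (phiCut L T s) :=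
  (contDiff_psiCut L).mul contDiff_const

/-- `ψ_L` vanishes outside the cylinder `{r < 2, |y₂| < L}`. [folklore] -/
theorem psiCut_eq_zero_of_not_mem {L : ℝ} {y : ℝ³} (hy : ¬ (cylRadius y < 2 ∧ |y 2| < L)) :
    psiCut L y = 0 := by
  rw [not_and_or, not_lt, not_lt] at hy
  rcases hy with hy | hy
  · rw [psiCut, xiCut_of_two_le hy, zero_mul]
  · rw [psiCut, Calculus.cutoff_eq_zero hy, mul_zero]

/-- `φ` vanishes outside the cylinder `{r < 2, |y₂| < L}`. [folklore] -/
theorem phiCut_eq_zero_of_not_mem {L T s : ℝ} {y : ℝ³} (hy : ¬ (cylRadius y < 2 ∧ |y 2| < L)) :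
    phiCut L T s y = 0 := by
  rw [phiCut, psiCut_eq_zero_of_not_mem hy, zero_mul]

/-- `φ` vanishes outside the time window `(1, T)`. [folklore] -/
theorem phiCut_eq_zero_of_not_mem_Ioo {L T s : ℝ} (hs : s ∉ Ioo 1 T) (y : ℝ³) :
    phiCut L T s y = 0 := by
  rw [phiCut, zetaCut_of_not_mem_Ioo hs, mul_zero]

/-- The topological support of `ψ_L` lies in the closed cylinder `{r ≤ 2, |y₂| ≤ L}`.
[folklore] -/
theorem tsupport_psiCut_subset (L : ℝ) :
    tsupport (psiCut L) ⊆ {y : ℝ³ | cylRadius y ≤ 2 ∧ |y 2| ≤ L} := by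
  have hclosed : IsClosed {y : ℝ³ | cylRadius y ≤ 2 ∧ |y 2| ≤ L} :=
    (isClosed_le continuous_cylRadius continuous_const).inter
      (isClosed_le (continuous_abs.comp (PiLp.continuous_apply 2 _ 2)) continuous_const)
  refine closure_minimal (fun y hy => ?_) hclosed
  by_contra h
  simp only [mem_setOf_eq, not_and_or, not_le] at h
  apply hy
  apply psiCut_eq_zero_of_not_mem
  rintro ⟨h1, h2⟩
  rcases h with h | h <;> linarith

/-- The topological support of `φ(s, ·)` lies in the closed cylinder `{r ≤ 2, |y₂| ≤ L}`.
[folklore] -/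
theorem tsupport_phiCut_subset (L T s : ℝ) :
    tsupport (phiCut L T s) ⊆ {y : ℝ³ | cylRadius y ≤ 2 ∧ |y 2| ≤ L} := by
  refine (tsupport_mul_subset_left (f := psiCut L) (g := fun _ => zetaCut T s)).trans
    (tsupport_psiCut_subset L)

/-- The closed cylinder `{r ≤ 2, |y₂| ≤ L}` lies in the ball of radius `2 + |L|`. [folklore] -/
theorem cylinder_subset_closedBall (L : ℝ) :
    {y : ℝ³ | cylRadius y ≤ 2 ∧ |y 2| ≤ L} ⊆ closedBall (0 : ℝ³) (2 + |L|) := by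
  rintro y ⟨h1, h2⟩
  rw [mem_closedBall, dist_zero_right]
  have hn : ‖y‖ ^ 2 = cylRadius y ^ 2 + y 2 ^ 2 := by
    rw [EuclideanSpace.real_norm_sq_eq, Fin.sum_univ_three, cylRadius_sq]
  have hr := cylRadius_nonneg y
  have hL : |y 2| ≤ |L| := h2.trans (le_abs_self L)
  have hy2 : y 2 ^ 2 ≤ |L| ^ 2 := by
    rw [← sq_abs (y 2)]; exact pow_le_pow_left₀ (abs_nonneg _) hL 2
  have : ‖y‖ ^ 2 ≤ (2 + |L|) ^ 2 := by nlinarith [abs_nonneg L]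
  exact (pow_le_pow_iff_left₀ (norm_nonneg y) (by positivity) two_ne_zero).1 this

/-- **`ψ_L` has compact support.** [folklore] -/
theorem hasCompactSupport_psiCut (L : ℝ) : HasCompactSupport (psiCut L) :=
  HasCompactSupport.of_support_subset_isCompact (isCompact_closedBall (0 : ℝ³) (2 + |L|))
    ((subset_tsupport _).trans ((tsupport_psiCut_subset L).trans (cylinder_subset_closedBall L)))

/-- **`φ(s, ·)` has compact support.** [folklore] -/
theorem hasCompactSupport_phiCut (L T s : ℝ) : HasCompactSupport (phiCut L T s) :=
  HasCompactSupport.of_support_subset_isCompact (isCompact_closedBall (0 : ℝ³) (2 + |L|))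
    ((subset_tsupport _).trans ((tsupport_phiCut_subset L T s).trans (cylinder_subset_closedBall L)))

/-- **`ψ_L` is axisymmetric.** [folklore] -/
theorem isAxisymmetricScalar_psiCut (L : ℝ) : IsAxisymmetricScalar (psiCut L) := by
  intro θ y
  simp only [psiCut, cylRadius_rotZ, rotZ_apply_two]

/-- **`φ(s, ·)` is axisymmetric.** [folklore] -/
theorem isAxisymmetricScalar_phiCut (L T s : ℝ) : IsAxisymmetricScalar (phiCut L T s) := by
  intro θ y
  simp only [phiCut, isAxisymmetricScalar_psiCut L θ y]

/-- `0 ≤ ψ ≤ 1`. [folklore] -/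
theorem psiCut_mem_Icc (L : ℝ) (y : ℝ³) : psiCut L y ∈ Icc (0 : ℝ) 1 := by
  obtain ⟨a0, a1⟩ := xiCut_mem_Icc (cylRadius y)
  obtain ⟨b0, b1⟩ := etaCut_mem_Icc L (y 2)
  exact ⟨mul_nonneg a0 b0, mul_le_one₀ a1 b0 b1⟩

/-- `0 ≤ φ ≤ 1`. [folklore] -/
theorem phiCut_mem_Icc (L T s : ℝ) (y : ℝ³) : phiCut L T s y ∈ Icc (0 : ℝ) 1 := by
  obtain ⟨a0, a1⟩ := psiCut_mem_Icc L y
  obtain ⟨c0, c1⟩ := zetaCut_mem_Icc T s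
  exact ⟨mul_nonneg a0 c0, mul_le_one₀ a1 c0 c1⟩

/-- **The time derivative of the cut-off**: `∂ₛφ = ψ(y) ζ'(s)`. [folklore] -/
theorem hasDerivAt_phiCut (L T s : ℝ) (y : ℝ³) :
    HasDerivAt (fun s => phiCut L T s y) (psiCut L y * deriv (zetaCut T) s) s := by
  unfold phiCut
  exact (hasDerivAt_zetaCut T s).const_mul _

/-- `|∂ₛφ| ≤ 2 C_S` (and `∂ₛφ = 0` unless `s ∈ [1, 2] ∪ [T − 1, T]`, `deriv_zetaCut_eq_zero`).
[folklore] -/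
theorem abs_psiCut_mul_deriv_zetaCut_le (L T s : ℝ) (y : ℝ³) :
    |psiCut L y * deriv (zetaCut T) s| ≤ 2 * smoothTransitionC2Bound := by
  obtain ⟨a0, a1⟩ := psiCut_mem_Icc L y
  rw [abs_mul, abs_of_nonneg a0]
  have h := abs_deriv_zetaCut_le T s
  have h0 := smoothTransitionC2Bound_nonneg
  calc psiCut L y * |deriv (zetaCut T) s| ≤ 1 * (2 * smoothTransitionC2Bound) := by gcongr
    _ = 2 * smoothTransitionC2Bound := by ring

/-! ### The cut-off on the unit cylinder: `φ = η(y₂) ζ(s)` there -/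

/-- On the open unit cylinder `{r < 1}` the spatial cut-off is `η_L(y₂)` near every point.
[folklore] -/
theorem psiCut_eventuallyEq {L : ℝ} {y : ℝ³} (hy : cylRadius y < 1) :
    psiCut L =ᶠ[𝓝 y] fun w => Calculus.cutoff L (w 2) := by
  filter_upwards [(isOpen_lt continuous_cylRadius continuous_const).mem_nhds hy] with w hw
  rw [psiCut, xiCut_of_le_one (le_of_lt hw), one_mul]

/-- On `{r < 1}`: `φ(s, ·) = ζ(s) η_L(·₂)` near every point. [folklore] -/
theorem phiCut_eventuallyEq {L T s : ℝ} {y : ℝ³} (hy : cylRadius y < 1) :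
    phiCut L T s =ᶠ[𝓝 y] zetaCut T s • fun w : ℝ³ => Calculus.cutoff L (w 2) := by
  filter_upwards [psiCut_eventuallyEq (L := L) hy] with w hw
  rw [phiCut, hw, Pi.smul_apply, smul_eq_mul, mul_comm]

/-- **The gradient of the cut-off on the unit cylinder**: `Dφ(s,y)v = ζ(s) η'(y₂) v₂` for
`r(y) < 1` (only the axial derivative survives; KNSS: `|φ_{,z}| ≤ 1`, used in the bound
`|II| ≤ C δ T₁` over `{r ≤ δ}`). [folklore] -/
theorem fderiv_phiCut_of_cylRadius_lt_one {L T s : ℝ} {y : ℝ³} (hy : cylRadius y < 1) (v : ℝ³) :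
    fderiv ℝ (phiCut L T s) y v = zetaCut T s * deriv (Calculus.cutoff L) (y 2) * v 2 := by
  rw [(phiCut_eventuallyEq (L := L) (T := T) (s := s) hy).fderiv_eq]
  have h := (hasFDerivAt_etaCut_comp_apply_two L y).const_smul (zetaCut T s)
  rw [h.fderiv]
  simp only [_root_.smul_apply, smul_eq_mul, PiLp.proj_apply]
  ring

/-- The Laplacian of `y ↦ η(y₂)` on `ℝ³` is `η''(y₂)`. [folklore] -/
theorem laplacian_etaCut_comp_apply_two (L : ℝ) (y : ℝ³) :
    (Δ fun w : ℝ³ => Calculus.cutoff L (w 2)) y = deriv (deriv (Calculus.cutoff L)) (y 2) := by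
  classical
  set b := EuclideanSpace.basisFun (Fin 3) ℝ with hb
  set P : ℝ³ →L[ℝ] ℝ := EuclideanSpace.proj (2 : Fin 3) with hP
  have hfun : (fun w : ℝ³ => Calculus.cutoff L (w 2)) = Calculus.cutoff L ∘ ⇑P := rfl
  rw [hfun, laplacian_eq_iteratedFDeriv_orthonormalBasis _ b]
  simp only
  have hkey : ∀ j : Fin 3, iteratedFDeriv ℝ 2 (Calculus.cutoff L ∘ ⇑P) y ![b j, b j] =
      (b j 2 * b j 2) * deriv (deriv (Calculus.cutoff L)) (y 2) := by
    intro j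
    rw [P.iteratedFDeriv_comp_right (Calculus.contDiff_cutoff L (n := 2)) y (i := 2) (by norm_cast),
      ContinuousMultilinearMap.compContinuousLinearMap_apply,
      iteratedFDeriv_apply_eq_iteratedDeriv_mul_prod, iteratedDeriv_succ, iteratedDeriv_one]
    simp only [Fin.prod_univ_two, Matrix.cons_val_zero, Matrix.cons_val_one, smul_eq_mul, hP,
      PiLp.proj_apply]
  rw [Fin.sum_univ_three, hkey 0, hkey 1, hkey 2]
  simp [hb]

/-- **The Laplacian of the cut-off on the unit cylinder**: `Δφ(s,y) = ζ(s) η''(y₂)` for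
`r(y) < 1` (KNSS: the term `III = ∫ (f − M)(−Δφ)` over `{r ≤ δ}`). [folklore] -/
theorem laplacian_phiCut_of_cylRadius_lt_one {L T s : ℝ} {y : ℝ³} (hy : cylRadius y < 1) :
    (Δ (phiCut L T s)) y = zetaCut T s * deriv (deriv (Calculus.cutoff L)) (y 2) := by
  have hev := phiCut_eventuallyEq (L := L) (T := T) (s := s) hy
  have h2 : (Δ (phiCut L T s)) y = (Δ (zetaCut T s • fun w : ℝ³ => Calculus.cutoff L (w 2))) y := by
    rw [laplacian_eq_iteratedFDeriv_stdOrthonormalBasis, laplacian_eq_iteratedFDeriv_stdOrthonormalBasis]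
    simp only [(hev.iteratedFDeriv ℝ 2).eq_of_nhds]
  rw [h2, InnerProductSpace.laplacian_smul _ (contDiff_etaCut_comp_apply_two L).contDiffAt,
    laplacian_etaCut_comp_apply_two, smul_eq_mul]

/-! ### The radial derivative of the cut-off: `Dφ[e_r] = ξ'(r) η ζ` -/

/-- **The radial derivative of the spatial cut-off**: `Dψ(y)[e_r(y)] = ξ'(r(y)) η(y₂)` for all
`y` (on the axis both sides vanish: `e_r = 0` and `ξ' = 0` near `0`). [folklore] -/
theorem fderiv_psiCut_apply_eR (L : ℝ) (y : ℝ³) :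
    fderiv ℝ (psiCut L) y (eR y) = deriv xiCut (cylRadius y) * Calculus.cutoff L (y 2) := by
  by_cases hy : cylRadius y = 0
  · have h0 : eR y = 0 := by simp [eR, hy]
    rw [h0, map_zero, hy, deriv_xiCut_of_lt_one one_pos, zero_mul]
  · -- product rule off the axis
    have hxi : HasFDerivAt (fun w : ℝ³ => xiCut (cylRadius w))
        (deriv xiCut (cylRadius y) • fderiv ℝ cylRadius y) y :=
      ((contDiff_xiCut (n := 1)).differentiable one_ne_zero (cylRadius y)).hasDerivAt.comp_hasFDerivAt
        y (hasFDerivAt_cylRadius hy).differentiableAt.hasFDerivAt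
    have heta := hasFDerivAt_etaCut_comp_apply_two L y
    have hprod := hxi.fun_mul heta
    rw [show psiCut L = fun w => xiCut (cylRadius w) * Calculus.cutoff L (w 2) from rfl, hprod.fderiv]
    simp only [_root_.add_apply, _root_.smul_apply, smul_eq_mul, PiLp.proj_apply, eR_apply_two,
      fderiv_cylRadius_apply_eR hy]
    ring

/-- **The radial derivative of the cut-off**: `Dφ(s,y)[e_r(y)] = ξ'(r) η(y₂) ζ(s)` (KNSS 2009,
(5.19)–(5.20): `∫ (2/r) f φ_{,r}` with `φ_{,r} = ξ'(r) η ζ`). [cite: KochNadirashviliSereginSverak2009, proof of Thm 5.3, (5.19)–(5.20) (arXiv p. 10)] -/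
theorem fderiv_phiCut_apply_eR (L T s : ℝ) (y : ℝ³) :
    fderiv ℝ (phiCut L T s) y (eR y) =
      deriv xiCut (cylRadius y) * Calculus.cutoff L (y 2) * zetaCut T s := by
  have hd : DifferentiableAt ℝ (psiCut L) y :=
    (contDiff_psiCut L (n := 1)).differentiable one_ne_zero y
  rw [show phiCut L T s = fun w => psiCut L w * zetaCut T s from rfl, fderiv_mul_const hd,
    _root_.smul_apply, smul_eq_mul, fderiv_psiCut_apply_eR]
  ring

/-! ### Global bounds by compactness -/

/-- **Uniform bounds on the gradient and the Laplacian of the cut-off** (for fixed `L`; KNSS: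
these only multiply the `O(ε)` terms on `{r ≥ δ}`): there is `B` with `‖Dφ(s,y)‖ ≤ B` and
`|Δφ(s,y)| ≤ B` for all `s, y`. [folklore] -/
theorem exists_bound_fderiv_laplacian_phiCut (L T : ℝ) : ∃ B : ℝ, ∀ s y,
    ‖fderiv ℝ (phiCut L T s) y‖ ≤ B ∧ |(Δ (phiCut L T s)) y| ≤ B := by
  have hΨ : ContDiff ℝ 2 (psiCut L) := contDiff_psiCut L
  have hΨc := hasCompactSupport_psiCut L
  -- bounds for `ψ`
  obtain ⟨B₁, hB₁⟩ := (hΨ.continuous_fderiv (by norm_cast)).bounded_above_of_compact_support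
    (hΨc.fderiv (𝕜 := ℝ))
  have hΔc : HasCompactSupport (Δ (psiCut L)) := by
    refine HasCompactSupport.of_support_subset_isCompact hΨc.isCompact fun x hx => ?_
    by_contra h
    exact hx (laplacian_eq_zero_of_notMem_tsupport h)
  obtain ⟨B₂, hB₂⟩ := (continuous_laplacian hΨ).bounded_above_of_compact_support hΔc
  refine ⟨max B₁ B₂, fun s y => ⟨?_, ?_⟩⟩
  · have hd : DifferentiableAt ℝ (psiCut L) y := hΨ.differentiable (by norm_cast) y
    rw [show phiCut L T s = fun w => psiCut L w * zetaCut T s from rfl, fderiv_mul_const hd,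
      norm_smul, Real.norm_eq_abs]
    obtain ⟨c0, c1⟩ := zetaCut_mem_Icc T s
    calc |zetaCut T s| * ‖fderiv ℝ (psiCut L) y‖ ≤ 1 * B₁ := by
          rw [abs_of_nonneg c0]; gcongr; exact hB₁ y
      _ ≤ max B₁ B₂ := by rw [one_mul]; exact le_max_left _ _
  · have hfun : phiCut L T s = zetaCut T s • psiCut L := by
      funext w; simp [phiCut, mul_comm]
    rw [hfun, InnerProductSpace.laplacian_smul _ hΨ.contDiffAt, smul_eq_mul, abs_mul]
    obtain ⟨c0, c1⟩ := zetaCut_mem_Icc T s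
    have := hB₂ y
    rw [Real.norm_eq_abs] at this
    calc |zetaCut T s| * |(Δ (psiCut L)) y| ≤ 1 * B₂ := by
          rw [abs_of_nonneg c0]; gcongr
      _ ≤ max B₁ B₂ := by rw [one_mul]; exact le_max_right _ _

end ThreeD

end Literature.Analysis.FluidPDE

end
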